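import Summits.ResolutionOfSingularities.ResolutionOfSingularities.Theorems.PurelyInseparableDim4MohAlongBound
import HarnessLib

/-!
# Purely inseparable four-folds — two consecutive edges with translated points: Moh's `+1` is governed by
# the COMPOSITE point of the first centre (PR-1 (b), structural form)

[OURS · counted 0 · cell `res-dim4-pi`, D-0157 DOOR 2, brick PR-1 (b); AI work, weaker than expert review]
Nothing here is a statement about resolution of singularities (NOT proved in dimension `≥ 4` /
characteristic `p` anywhere in this programme).

Why no second rise was ever observed after a jump even when the move killed Moh's witness
(`PurelyInseparableDim4MohAlongWitnessLoss.lean`, cell bus 17:27Z (E3)): two consecutive edges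
`s —[C_S, chart j, point b' + c]→ s₁ —[C_{S₁}, chart j₁, point b'₁ + γ]→ s₂` are, when the new exceptional
component lies in the second centre (`γ_j = 0`) and no lost component is revisited (no «boundary
amnesia», `PurelyInseparableDim4BoundaryAmnesia.lean`), an HONEST two-step fibre chain starting from the
state `s` moved to the COMPOSITE point `c + γ|_{Sᶜ}` of the first centre:

* §1 `deletePthPowers_translate_deletePthPowers` (cleaning commutes with moving) and
  **`translate_step_eq_step_add`** — moving a stepped state by `γ` (`γ_j = 0`, no revisit) IS stepping at
  the point `b + γ`: `(step q S j b s)@γ = step q S j (b + γ) s`;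
* §2 **`shade_step_step_le_shade_composite_add_one`** — hence, by the tree's one-step theorems at the
  composite point (`mohBound_one`, `exists_witness_of_shadeIncreases`, `shade_step_le_of_witness`):
  `shade(s₂) ≤ shade(s@(c + γ|_{Sᶜ})) + 1` whenever `C_S` satisfies (1) at `s` and (2) at the composite
  point, and `C_{S₁}` satisfies (1) at `s₁` and (2) at the moved state `s₁@γ`; in particular
  (`shade_step_step_le_add_one_of_composite_silent`) **no double rise** `shade(s₂) ≤ shade(s) + 1` as
  soon as the COMPOSITE point is silent for `s` — no witness or face-sum clause at `γ` is needed. So a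
  violation of Moh's stability along a no-jump zigzag requires: the composite point special while both
  individual moves are silent, or a revisited component, or a non-nested chart variable (`γ_j ≠ 0`).

bears_on: LADDER-RESOLUTION:D157-DOOR2 (res-dim4-pi · PR-1 (b)). Supports
stmt-ResolutionOfSingularities-16155 (helper).
-/

set_option linter.dupNamespace false

noncomputable section

open MvPolynomial Finset

open scoped BigOperators

namespace Summit.ResolutionOfSingularities.ResolutionOfSingularities.Theorems.PIDim4

open Literature.AlgebraicGeometry.Resolution
open Literature.AlgebraicGeometry.Resolution.Hauser2010
open Literature.AlgebraicGeometry.Resolution.CentreBlowup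
open Literature.Barriers.ResolutionOfSingularities

namespace MohAlong

/-! ## 1. Moving a stepped state = stepping at the translated point -/

section Composite

variable {σ : Type*} {K : Type*} [Field K] [Fintype σ] [DecidableEq σ] [DecidableEq K]
variable (p : ℕ) [hp : Fact p.Prime] [CharP K p]

omit [Fintype σ] [DecidableEq K] in
/-- **Cleaning commutes with moving** (`q = pⁿ`, characteristic `p`): the `q`-th power monomials deleted
before the translation would be deleted after it anyway. [folklore] -/
theorem deletePthPowers_translate_deletePthPowers (n : ℕ) (b : σ → K) (T : MvPolynomial σ K) :
    deletePthPowers (p ^ n) (PointBlowup.translate b (deletePthPowers (p ^ n) T)) =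
      deletePthPowers (p ^ n) (PointBlowup.translate b T) := by
  have hsplit : T = deletePthPowers (p ^ n) T +
      ∑ d ∈ T.support with IsPthPowerExponent (p ^ n) d, monomial d (coeff d T) := by
    unfold deletePthPowers
    rw [add_comm, Finset.sum_filter_add_sum_filter_not]
    exact T.as_sum
  conv_rhs => rw [hsplit]
  rw [translate_add, deletePthPowers_add, PointBlowup.translate_finset_sum, deletePthPowers_finset_sum,
    Finset.sum_eq_zero, add_zero]
  intro d hd
  exact deletePthPowers_translate_monomial_eq_zero p n b (Finset.mem_filter.mp hd).2 _

omit [Fintype σ] [DecidableEq K] hp [CharP K p] in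
/-- The decomposition of a vector into its part on `S` and its part off `S`. [folklore] -/
theorem piecewise_add_piecewise_gen (S : Finset σ) (γ : σ → K) :
    S.piecewise γ (0 : σ → K) + S.piecewise (0 : σ → K) γ = γ := by
  funext i
  rw [Pi.add_apply, Finset.piecewise, Finset.piecewise]
  split_ifs
  · rw [Pi.zero_apply, add_zero]
  · rw [Pi.zero_apply, zero_add]

omit [Fintype σ] in
/-- **Moving a stepped state is stepping at the translated point** (`q = pⁿ`, characteristic `p`): if
`γ` vanishes at the chart variable (`γ_j = 0`: the new exceptional component passes through the new
point) and no component lost at `b` is revisited (`b_i + γ_i = 0 ⇒ b_i = 0`, i.e. no boundary amnesia),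
then `(step q S j b s)@γ = step q S j (b + γ) s` as presented states. [folklore] -/
theorem translate_step_eq_step_add (n : ℕ) {S : Finset σ} {j : σ} (b γ : σ → K) (hγj : γ j = 0)
    (hret : ∀ i, i ≠ j → b i + γ i = 0 → b i = 0) (s : CState σ K) :
    (⟨deletePthPowers (p ^ n) (PointBlowup.translate γ (step (p ^ n) S j b s).F),
        (step (p ^ n) S j b s).r.filter (fun i => γ i = 0),
        (step (p ^ n) S j b s).exc.filter (fun i => γ i = 0)⟩ : CState σ K) =
      step (p ^ n) S j (b + γ) s := by
  have hiff : ∀ i, i ≠ j → (b i + γ i = 0 ↔ b i = 0 ∧ γ i = 0) := fun i hi => by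
    constructor
    · intro h
      have hb := hret i hi h
      rw [hb, zero_add] at h
      exact ⟨hb, h⟩
    · rintro ⟨h1, h2⟩
      rw [h1, h2, add_zero]
  simp only [step, CState.mk.injEq]
  refine ⟨?_, ?_, ?_⟩
  · unfold pointTransform
    rw [deletePthPowers_translate_deletePthPowers p n, translate_translate, add_comm γ b]
  · unfold newMult
    ext i
    simp only [Finsupp.filter_apply, Finsupp.update_apply, Pi.add_apply]
    by_cases hij : i = j
    · subst hij
      rw [if_pos hγj, if_pos rfl, if_pos rfl]
    · rw [if_neg hij, if_neg hij]
      by_cases h1 : b i = 0 <;> by_cases h2 : γ i = 0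
      · rw [if_pos h2, if_pos h1, if_pos ((hiff i hij).mpr ⟨h1, h2⟩)]
      · rw [if_neg h2, if_neg (fun h => h2 ((hiff i hij).mp h).2)]
      · rw [if_pos h2, if_neg h1, if_neg (fun h => h1 ((hiff i hij).mp h).1)]
      · rw [if_neg h2, if_neg (fun h => h2 ((hiff i hij).mp h).2)]
  · unfold newExc
    ext i
    simp only [Finset.mem_filter, Finset.mem_insert, Pi.add_apply]
    by_cases hij : i = j
    · subst hij
      exact ⟨fun _ => Or.inl rfl, fun _ => ⟨Or.inl rfl, hγj⟩⟩
    · rw [hiff i hij]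
      constructor
      · rintro ⟨h | ⟨hi, hb⟩, hγ⟩
        · exact absurd h hij
        · exact Or.inr ⟨hi, hb, hγ⟩
      · rintro (h | ⟨hi, hb, hγ⟩)
        · exact absurd h hij
        · exact ⟨Or.inr ⟨hi, hb⟩, hγ⟩

end Composite

/-! ## 2. Two consecutive edges: the bound through the composite point -/

section TwoEdges

variable {σ : Type*} {K : Type*} [Field K] [Fintype σ] [DecidableEq σ] [DecidableEq K]
variable (p : ℕ) [hp : Fact p.Prime] [CharP K p]

/-- **Two edges = an honest two-step chain from the composite point.** With `s₁ = step p S j (b' + c) s`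
(`b'` fibre coordinate, `c` on `C_S`) and the second move `γ` (`γ_j = 0`, no revisit), the moved state
`s₁@γ` is the fibre-point step, at `b' + γ|_S`, of `s` moved to the COMPOSITE point `c + γ|_{Sᶜ}` of the
first centre. [folklore] -/
theorem translate_step_add_eq {S : Finset σ} {j : σ} (hj : j ∈ S) (b' c γ : σ → K)
    (hb' : ∀ i, i ∉ S → b' i = 0) (hc : ∀ i ∈ S, c i = 0) (hγj : γ j = 0)
    (hret : ∀ i, i ≠ j → (b' + c) i + γ i = 0 → (b' + c) i = 0) (s : CState σ K)
    (hclean : deletePthPowers p s.F = s.F) :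
    (⟨deletePthPowers p (PointBlowup.translate γ (step p S j (b' + c) s).F),
        (step p S j (b' + c) s).r.filter (fun i => γ i = 0),
        (step p S j (b' + c) s).exc.filter (fun i => γ i = 0)⟩ : CState σ K) =
      step p S j (b' + S.piecewise γ (0 : σ → K))
        ⟨deletePthPowers p (PointBlowup.translate (c + S.piecewise (0 : σ → K) γ) s.F),
          s.r.filter (fun i => (c + S.piecewise (0 : σ → K) γ) i = 0),
          s.exc.filter (fun i => (c + S.piecewise (0 : σ → K) γ) i = 0)⟩ := by
  have h := translate_step_eq_step_add (K := K) p 1 (S := S) (b' + c) γ hγj hret s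
  rw [pow_one] at h
  rw [h, ← step_add_eq_step_translate_clean_one p hj (b' + S.piecewise γ (0 : σ → K)) (c + S.piecewise (0 : σ → K) γ)
    (fun i hi => by rw [Pi.add_apply, hb' i hi, Finset.piecewise, if_neg hi, Pi.zero_apply, add_zero])
    (fun i hi => by rw [Pi.add_apply, hc i hi, Finset.piecewise, if_pos hi, Pi.zero_apply, add_zero])
    s hclean]
  congr 1
  conv_lhs => rw [← piecewise_add_piecewise_gen S γ]
  exact add_add_add_comm b' c _ _

/-- **Moh's `+1` over two consecutive edges is governed by the composite point.** Let
`s₁ = step p S j (b' + c) s` and `s₂ = step p S₁ j₁ (b'₁ + γ) s₁` be two consecutive edges (`j ∈ S`,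
`j₁ ∈ S₁`, `b'`, `b'₁` fibre coordinates, `c`, `γ` on the respective centres) with `γ_j = 0` (the new
component `{y_j = 0}` passes through the second point — e.g. `j ∈ S₁`) and no revisited component. Let
`s` be clean with `F ≠ 0`, `y^r ∣ F`; suppose `C_S` satisfies (1) at `s` and (2) at `s` moved to the
COMPOSITE point `c + γ|_{Sᶜ}`, and `C_{S₁}` satisfies (1) at `s₁` and (2) at the moved state `s₁@γ`.
Then `shade(s₂) ≤ shade(s@(c + γ|_{Sᶜ})) + 1` — by the tree's one-step theorems along the honest chain
`s@(c + γ|_{Sᶜ}) → s₁@γ → s₂` (an increase at the first step creates Moh's witness AT `s₁@γ` itself,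
which forbids the second; otherwise Moh's bound at the second step). No witness or face-sum clause at
`γ` is needed. [cite: Moh1987, Stability Theorem (Introduction p. 966) and §1 (pp. 972–973)] -/
theorem shade_step_step_le_shade_composite_add_one {S S₁ : Finset σ} {j j₁ : σ} (hj : j ∈ S)
    (hj₁ : j₁ ∈ S₁) (b' c b'₁ γ : σ → K) (hb'j : b' j = 0) (hb' : ∀ i, i ∉ S → b' i = 0)
    (hc : ∀ i ∈ S, c i = 0) (hb'₁j : b'₁ j₁ = 0) (hb'₁ : ∀ i, i ∉ S₁ → b'₁ i = 0)
    (hγ : ∀ i ∈ S₁, γ i = 0) (hγj : γ j = 0)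
    (hret : ∀ i, i ≠ j → (b' + c) i + γ i = 0 → (b' + c) i = 0)
    (s s₁ s₂ : CState σ K) (hs₁ : s₁ = step p S j (b' + c) s) (hs₂ : s₂ = step p S₁ j₁ (b'₁ + γ) s₁)
    (hclean : deletePthPowers p s.F = s.F) (hF : s.F ≠ 0) (hr : ∀ d ∈ s.F.support, s.r ≤ d)
    (hq : ∀ d ∈ s.F.support, p ≤ degIn S d) (hq₁ : ∀ d ∈ s₁.F.support, p ≤ degIn S₁ d)
    (hperm₀ : ((degIn S (s.r.filter (fun i => (c + S.piecewise (0 : σ → K) γ) i = 0)) : ℕ) : ℕ∞) +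
        CState.shade ⟨deletePthPowers p (PointBlowup.translate (c + S.piecewise (0 : σ → K) γ) s.F),
          s.r.filter (fun i => (c + S.piecewise (0 : σ → K) γ) i = 0),
          s.exc.filter (fun i => (c + S.piecewise (0 : σ → K) γ) i = 0)⟩ ≤
      ordAlong S (deletePthPowers p (PointBlowup.translate (c + S.piecewise (0 : σ → K) γ) s.F)))
    (hperm₁ : ((degIn S₁ (s₁.r.filter (fun i => γ i = 0)) : ℕ) : ℕ∞) +
        CState.shade ⟨deletePthPowers p (PointBlowup.translate γ s₁.F),
          s₁.r.filter (fun i => γ i = 0), s₁.exc.filter (fun i => γ i = 0)⟩ ≤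
      ordAlong S₁ (deletePthPowers p (PointBlowup.translate γ s₁.F))) :
    s₂.shade ≤ CState.shade ⟨deletePthPowers p (PointBlowup.translate (c + S.piecewise (0 : σ → K) γ) s.F),
      s.r.filter (fun i => (c + S.piecewise (0 : σ → K) γ) i = 0),
      s.exc.filter (fun i => (c + S.piecewise (0 : σ → K) γ) i = 0)⟩ + 1 := by
  -- the composite point and the honest chain σ₀ → σ₁ → s₂
  set cc : σ → K := c + S.piecewise (0 : σ → K) γ with hcc
  set bb : σ → K := b' + S.piecewise γ (0 : σ → K) with hbb
  set σ₀ : CState σ K := ⟨deletePthPowers p (PointBlowup.translate cc s.F),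
    s.r.filter (fun i => cc i = 0), s.exc.filter (fun i => cc i = 0)⟩ with hσ₀
  set M₁ : CState σ K := ⟨deletePthPowers p (PointBlowup.translate γ s₁.F),
    s₁.r.filter (fun i => γ i = 0), s₁.exc.filter (fun i => γ i = 0)⟩ with hM₁
  have hccS : ∀ i ∈ S, cc i = 0 := fun i hi => by
    rw [hcc, Pi.add_apply, hc i hi, Finset.piecewise, if_pos hi, Pi.zero_apply, add_zero]
  have hbbN : ∀ i, i ∉ S → bb i = 0 := fun i hi => by
    rw [hbb, Pi.add_apply, hb' i hi, Finset.piecewise, if_neg hi, Pi.zero_apply, add_zero]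
  have hbbj : bb j = 0 := by
    rw [hbb, Pi.add_apply, hb'j, Finset.piecewise, if_pos hj, hγj, add_zero]
  have hM₁eq : M₁ = step p S j bb σ₀ := by
    rw [hM₁, hs₁]
    exact translate_step_add_eq p hj b' c γ hb' hc hγj hret s hclean
  -- the first moved state σ₀: package of hypotheses
  have hσ₀F : σ₀.F ≠ 0 := clean_translate_ne_zero p cc hclean hF
  obtain ⟨o₀, ho₀⟩ := exists_ordZero_eq_natCast hσ₀F
  have hcl₀ : deletePthPowers p σ₀.F = σ₀.F := PointBlowup.deletePthPowers_deletePthPowers p _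
  have hr₀ : ∀ e ∈ σ₀.F.support, σ₀.r ≤ e := fun e he =>
    filter_le_of_mem_support_clean_translate p cc hr he
  have hq₀ : ∀ e ∈ σ₀.F.support, p ≤ degIn S e := fun e he =>
    le_degIn_of_mem_support_clean_translate p cc hccS hq he
  have hperm₀N := perm_of_shade_le_ordAlong σ₀ ho₀ hperm₀
  -- the second moved state M₁ = σ₁: package of hypotheses
  have hcl₁s : deletePthPowers p s₁.F = s₁.F := by rw [hs₁]; exact deletePthPowers_step p S j _ s
  have hσ₁F : M₁.F ≠ 0 := by
    rw [hM₁eq]; exact step_F_ne_zero p hj bb hbbj hbbN σ₀ hcl₀ ho₀ hr₀ hq₀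
  obtain ⟨o₁, ho₁⟩ := exists_ordZero_eq_natCast hσ₁F
  have hcl₁ : deletePthPowers p M₁.F = M₁.F := PointBlowup.deletePthPowers_deletePthPowers p _
  have hr₁ : ∀ e ∈ M₁.F.support, M₁.r ≤ e := by
    rw [hM₁eq]; exact newMult_le_of_mem_support_step p S j bb hbbj σ₀ ho₀ hr₀ hperm₀N
  have hq₁M : ∀ e ∈ M₁.F.support, p ≤ degIn S₁ e := fun e he =>
    le_degIn_of_mem_support_clean_translate p γ hγ hq₁ he
  have hperm₁N := perm_of_shade_le_ordAlong M₁ ho₁ hperm₁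
  -- s₂ is the fibre step of M₁
  have hs₂eq : s₂ = step p S₁ j₁ b'₁ M₁ := by
    rw [hs₂, step_add_eq_step_translate_clean_one p hj₁ b'₁ γ hb'₁ hγ s₁ hcl₁s]
  rw [hs₂eq]
  -- the two cases: increase at the first honest step or not
  have hMb := mohBound_one p hj bb hbbj hbbN σ₀ hcl₀ ho₀ hr₀ hq₀ hperm₀N
  rw [← hM₁eq] at hMb
  by_cases hinc : ShadeIncreases p S j bb σ₀
  · obtain ⟨i₀, oW, E, hoW, hE, hEdeg, hEi₀, hri₀⟩ :=
      exists_witness_of_shadeIncreases p hj bb hbbj hbbN σ₀ hcl₀ ho₀ hr₀ hq₀ hperm₀N hinc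
    rw [← hM₁eq] at hoW hE hri₀
    have hoo : oW = o₁ := by
      have := hoW.symm.trans ho₁
      exact_mod_cast this
    subst hoo
    exact le_trans (shade_step_le_of_witness p hj₁ b'₁ hb'₁j hb'₁ M₁ ho₁ hr₁ hq₁M hperm₁N hri₀ hE hEdeg
      hEi₀) hMb
  · have hle : M₁.shade ≤ σ₀.shade := by
      unfold ShadeIncreases at hinc
      rw [← hM₁eq] at hinc
      exact not_lt.mp hinc
    exact le_trans (mohBound_one p hj₁ b'₁ hb'₁j hb'₁ M₁ hcl₁ ho₁ hr₁ hq₁M hperm₁N)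
      (add_le_add hle le_rfl)

/-- **No double rise when the composite point is silent.** Same setting; if moreover the composite point
is silent for `s` (`shade(s@(c + γ|_{Sᶜ})) = shade(s)`) and `C_S` satisfies (2) at `s`, then
`shade(s₂) ≤ shade(s) + 1` — whatever happens to Moh's witness at the move `γ`. [cite: Moh1987,
Stability Theorem (Introduction p. 966)] -/
theorem shade_step_step_le_add_one_of_composite_silent {S S₁ : Finset σ} {j j₁ : σ} (hj : j ∈ S)
    (hj₁ : j₁ ∈ S₁) (b' c b'₁ γ : σ → K) (hb'j : b' j = 0) (hb' : ∀ i, i ∉ S → b' i = 0)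
    (hc : ∀ i ∈ S, c i = 0) (hb'₁j : b'₁ j₁ = 0) (hb'₁ : ∀ i, i ∉ S₁ → b'₁ i = 0)
    (hγ : ∀ i ∈ S₁, γ i = 0) (hγj : γ j = 0)
    (hret : ∀ i, i ≠ j → (b' + c) i + γ i = 0 → (b' + c) i = 0)
    (s s₁ s₂ : CState σ K) (hs₁ : s₁ = step p S j (b' + c) s) (hs₂ : s₂ = step p S₁ j₁ (b'₁ + γ) s₁)
    (hclean : deletePthPowers p s.F = s.F) (hF : s.F ≠ 0) (hr : ∀ d ∈ s.F.support, s.r ≤ d)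
    (hq : ∀ d ∈ s.F.support, p ≤ degIn S d) (hq₁ : ∀ d ∈ s₁.F.support, p ≤ degIn S₁ d)
    (hperm : ((degIn S s.r : ℕ) : ℕ∞) + s.shade ≤ ordAlong S s.F)
    (hsilent : CState.shade ⟨deletePthPowers p (PointBlowup.translate (c + S.piecewise (0 : σ → K) γ) s.F),
        s.r.filter (fun i => (c + S.piecewise (0 : σ → K) γ) i = 0),
        s.exc.filter (fun i => (c + S.piecewise (0 : σ → K) γ) i = 0)⟩ = s.shade)
    (hperm₁ : ((degIn S₁ (s₁.r.filter (fun i => γ i = 0)) : ℕ) : ℕ∞) +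
        CState.shade ⟨deletePthPowers p (PointBlowup.translate γ s₁.F),
          s₁.r.filter (fun i => γ i = 0), s₁.exc.filter (fun i => γ i = 0)⟩ ≤
      ordAlong S₁ (deletePthPowers p (PointBlowup.translate γ s₁.F))) :
    s₂.shade ≤ s.shade + 1 := by
  have hccS : ∀ i ∈ S, (c + S.piecewise (0 : σ → K) γ) i = 0 := fun i hi => by
    rw [Pi.add_apply, hc i hi, Finset.piecewise, if_pos hi, Pi.zero_apply, add_zero]
  have hperm₀ : ((degIn S (s.r.filter (fun i => (c + S.piecewise (0 : σ → K) γ) i = 0)) : ℕ) : ℕ∞) +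
      CState.shade ⟨deletePthPowers p (PointBlowup.translate (c + S.piecewise (0 : σ → K) γ) s.F),
        s.r.filter (fun i => (c + S.piecewise (0 : σ → K) γ) i = 0),
        s.exc.filter (fun i => (c + S.piecewise (0 : σ → K) γ) i = 0)⟩ ≤
      ordAlong S (deletePthPowers p (PointBlowup.translate (c + S.piecewise (0 : σ → K) γ) s.F)) := by
    rw [hsilent, degIn_filter_eq _ hccS, ordAlong_deletePthPowers_translate p _ hccS hclean]
    exact hperm
  have h := shade_step_step_le_shade_composite_add_one p hj hj₁ b' c b'₁ γ hb'j hb' hc hb'₁j hb'₁ hγ hγj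
    hret s s₁ s₂ hs₁ hs₂ hclean hF hr hq hq₁ hperm₀ hperm₁
  rwa [hsilent] at h

end TwoEdges

end MohAlong

end Summit.ResolutionOfSingularities.ResolutionOfSingularities.Theorems.PIDim4

end
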